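import Summits.QuantumFields.YangMills.Theorems.FluctuationComparisonRegPrIntLS2BetaIterAxialGaugeSup
import HarnessLib

/-!
# S2β · `hFlat` road (UV3-NODE §57.8 (B)) — THE RELATIVE STAGE-GAUGE TOWER EXISTS: top-down comb-axial gauges RELATIVE TO THE LIFT OF
# THE FINAL COARSER LEVEL (state-dependent backgrounds), with nesting, covariance, residuality and exact comb axiality

Cell `ym3-torus` (YM ladder rung R3 = continuum `SU(2)` Yang–Mills on the three-torus — a RUNG: NOT d = 4, NOT infinite volume, NOT a mass gap,
NOT Clay).  Width seat «width 17» `ym3-torus-px17` (gen 19), FREE px helper on crux `stmt-QuantumFields-20520`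
(`Theses.UnitScaleTilt.FluctuationComparisonRegPrIntL`); `--kind proof --supports stmt-QuantumFields-20520 --as helper`, count-neutral,
DEFINITION-FREE (0 `def`, 0 `instance`, 0 `notation`, 0 `sorry`, default heartbeats), generic gauge group, ANY family of one-step
averagings, ANY family of lift maps.

THE OBJECT (px8 g21, UV3-NODE §57.8 (B) «NONLINEAR ASSEMBLY = A RECURSION»): «run stages `t = m−1, …, 0` (coarse → fine): `g_t` := the comb-axial
gauge of the CURRENT level-`t` field relative to the BACKGROUND `I_t(U′_{t+1})` = lift of the FINAL level-`(t+1)` field …; a finer stage never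
moves a coarser average …; INVARIANT at the end: for every `t`, `U′_t = I_t(U′_{t+1}) · rel_t` with `rel_t = 1` EXACTLY on comb bonds».  The (iv)
assembler's docking list (px16 g20, UV3-NODE §63.4) asks for «the level objects `B_t := ‖d_g(U′_t)‖_{ℓ²}` over a RELATIVE tower
`U′_t = I_t(U′_{t+1})·rel_t`».  This file supplies the TOWER ITSELF — the gauge family and its five structural facts — for an ARBITRARY family
of lift maps `lift j : GaugeField P (j+1) G → GaugeField P j G` (instantiate with px12 g23's geodesic Whitney hat lift (ii-a⁺)) and an
arbitrary family of averagings `av` (instantiate with the (0.4) block average).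

WHY IT IS NOT ✓`…IterAxialGaugeSup.exists_iterAxialGauge (m) (A)` RE-INSTANTIATED.  That lemma builds `g_j x = g_{j+1}(blockOf x) · A_j x` for comb
factors `A_j : T^{(j)} → G` PRESCRIBED BEFORE the recursion runs.  Here (1) the background `V_j = lift_j (g_{j+1} • M^{j+1}U)` DEPENDS ON THE COARSER
GAUGE `g_{j+1}` (the hat lift is not gauge-covariant — px12 g23's F₂ locate), and (2) in the tree's convention `(u • V)(Γ_{y,x}) = u(y)·V(Γ_{y,x})·u(x)⁻¹`
(✓`Prop7AxialGauge.axialT_gaugeActT`) the background's comb holonomy enters on the LEFT of the centre value: the stage element is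
    `g_j x = V_j(Γ_{emb y, x})⁻¹ · g_{j+1}(y) · (M^jU)(Γ_{emb y, x})`,   `y = blockOf x`
(the element `U₀(Γ)⁻¹·U(Γ)` of ✓`Prop7AxialGauge.exists_axialGauge` — [Balaban1985Variational] (16)–(18) p.280 — with the centre value `g_{j+1}(y)` in the
middle).  So the recursion step is a STATE-DEPENDENT map `(Site P (j+1) → G) → (Site P j → G)`; §1 is px10 g21's 25-line codepth induction
verbatim for such steps, §2 instantiates it.

CONTENT.
* §1 `exists_rec_of_top` — for ANY type family `S : ℕ → Sort*`, top values `one j : S j` and STATE-DEPENDENT steps `F j : S (j+1) → S j`: for every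
  `m` there is `g` with `g j = one j` (`j ≥ m`) and `g j = F j (g (j+1))` (`j < m`).  (✓`exists_iterAxialGauge` is the case `F j g′ = fun x =>
  g′ (blockOf x) * A j x`.)
* §2 ★`axialT_gaugeAct_of_stage` (the one-site algebra of (T4) below: if `g (emb y) = g′ y` and
  `g x = V(Γ)⁻¹ · g′ y · U(Γ)` then `(g • U)(Γ_{emb y,x}) = V(Γ_{emb y,x})`), `bond_eq_of_axial` ((T4b): the bondwise reading «relative field `= 1` on a
  comb bond», px8 g21 (w1)), and
  ★★★ `exists_stageGaugeTower (av) (hm : m ≤ m_P + K_P) (lift) (U)` : there is `g : (j : ℕ) → T^{(j)} → G` with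
  (T0) the displayed recursion for `j < m`; (T1) `g_j ≡ 1` for `j ≥ m`; (T2) NESTING `g_j ∘ emb = g_{j+1}` (`j < m`; empty comb, ✓`axialT_self`);
  (T3) COVARIANCE `M^j(g_0 • X) = g_j • M^jX` for EVERY field `X` and every `j ≤ m` (✓`iter_gaugeAct_of_emb` BY NAME) and RESIDUALITY `M^m(g_0 • X) = M^mX`,
  (T6) also for the INVERSE family `M^m(g_0⁻¹ • X) = M^mX` (`g_0^{±1}` lie in print's group (4) of the `m`-fold average — the EXIT's comparison gauge `v := g_0⁻¹` of the
  registered orbit infimum, cf. ✓`…S2BetaFlatTubeWLOG.dist1_regauge_eq`); (T4) ★ COMB AXIALITY RELATIVE TO THE LIFT OF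
  THE FINAL COARSER LEVEL: `(g_j • M^jU)(Γ_{emb y,x}) = (lift_j (g_{j+1} • M^{j+1}U))(Γ_{emb y,x})` for every `j < m`, `x`, `y = blockOf x` — with
  `U′_j := g_j • M^jU`, `V_j := lift_j U′_{j+1}`, `rel_j := V_j⁻¹·U′_j` this is «`rel_j` trivial along every comb», the precondition for reading the
  lift's energy `√L·B_{j+1}` ON THE NOSE in the recursion (§53.3's criticality: no second copy of `B_{j+1}` may leak into `R_j`); (T5) ONE-STEP
  CONSISTENCY `M(U′_j) = U′_{j+1}` (`j < m`) — «a finer stage never moves a coarser average».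
* §3 `stage_coarse_eq_axialAvg_lift` — the shape in which px13 g22's (ii-b) face corollary consumes the tower: if the lift is a SECTION of some
  coarse reading `cavg` (px12 g23 (W1): `axialAvg (lift X) = X`), then `cavg (V_j) = M(U′_j)` — the background reproduces the average of the current
  field along the spine.

WHAT THIS FILE IS NOT.  Not the interior∕face READINGS of `rel_j` (px13 g22 (ii-b)), not the lift or its flap letter (px12 g23 (ii-a⁺)), not the KEY
LEMMA (px8 g21), not the `ℓ²` recursion or its solution (✓p814367∕✓p814904, px16 g20; the assembler).  Nothing here bounds anything.

HONEST SCOPE.  Group algebra and an induction; nothing of Bałaban's analysis is asserted or proved ([Balaban1985Variational] (16)–(18) p.280 and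
[Balaban1985RegularSpaces] (1.19) p.79 are the printed one-level gauge with background; the STAGE-WISE choice of backgrounds is px8 g21's design, not
print); `hFlat`, TUBE-REG∘, GAP♯∘ (`stub_uniformFibreGapOrbit`), S2β, crux 20520 and `YM3TorusSU2` are NOT proved; no registered stub is closed; rung
R3 = SU(2) YM₃ on T³ at fixed lattice data — NOT d = 4, NOT infinite volume, NOT a mass gap, NOT Clay; the Yang–Mills mass gap is NOT proved.
References: T. Bałaban, CMP **102** (1985) 277–309 [Balaban1985Variational] ((4) p.278, (16)–(18) p.280); CMP **99** (1985) 75–102 [Balaban1985RegularSpaces]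
((1.19) p.79); CMP **98** (1985) 17–51 [Balaban1985Averaging] ((8), (11) p.19).
-/

set_option autoImplicit false

namespace Summit.QuantumFields.YangMills.Theorems.FluctuationComparisonRegPrIntLS2BetaStageGaugeTower

open Literature.MathematicalPhysics.QuantumFieldTheory.Balaban1983to89
open B10Eq27TorusAxialLog (axialT axialT_self gaugeActT_eq_gaugeAct)
open Summit.QuantumFields.YangMills.Theorems.Prop7AxialGauge (axialT_gaugeActT)
open Summit.QuantumFields.YangMills.Theorems.FluctuationComparisonRegPrIntLS2BetaIterAxialGaugeSup (iter_gaugeAct_of_emb)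

/-! ## §1 State-dependent top-down recursion (generic) -/

section Rec

universe u

variable {S : ℕ → Sort u}

/-- **STATE-DEPENDENT CODEPTH RECURSION.**  For any type family `S`, top values `one j` and steps `F j : S (j+1) → S j`, and any top height `m`,
there is a family `g` with `g j = one j` for `j ≥ m` and `g j = F j (g (j+1))` for `j < m`.  Proof: induction on the codepth — extend a family
satisfying the recursion on `[m−t, m)` to `[m−t−1, m)` by redefining the single height `m−t−1` (px10 g21's ✓`exists_iterAxialGauge`, verbatim
for state-dependent steps). [cite: Balaban1985RegularSpaces, (1.19) p.79] -/
theorem exists_rec_of_top (m : ℕ) (one : (j : ℕ) → S j) (F : (j : ℕ) → S (j + 1) → S j) :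
    ∃ g : (j : ℕ) → S j, (∀ j, m ≤ j → g j = one j) ∧ ∀ j, j < m → g j = F j (g (j + 1)) := by
  suffices h : ∀ t : ℕ, ∃ g : (j : ℕ) → S j, (∀ j, m ≤ j → g j = one j) ∧
      ∀ j, j < m → m ≤ j + t → g j = F j (g (j + 1)) by
    obtain ⟨g, h1, h2⟩ := h m
    exact ⟨g, h1, fun j hj => h2 j hj (by omega)⟩
  intro t
  induction t with
  | zero => exact ⟨one, fun _ _ => rfl, fun j hj hjt => by omega⟩
  | succ t ih =>
    obtain ⟨g, h1, h2⟩ := ih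
    classical
    refine ⟨fun j => if j + (t + 1) = m then F j (g (j + 1)) else g j, ?_, ?_⟩
    · intro j hj
      have hne : ¬ (j + (t + 1) = m) := by omega
      simp only [hne, if_false]
      exact h1 j hj
    · intro j hj hjt
      by_cases hjm : j + (t + 1) = m
      · have hne : ¬ (j + 1 + (t + 1) = m) := by omega
        simp only [hjm, if_true, hne, if_false]
      · have hne : ¬ (j + 1 + (t + 1) = m) := by omega
        simp only [hjm, if_false, hne]
        exact h2 j hj (by omega)

end Rec

/-! ## §2 The relative stage-gauge tower -/

section Tower

variable {P : Params} {G : Type*} [GaugeGroup G]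

/-- ★ **THE ONE-SITE ALGEBRA OF THE STAGE GAUGE** ([Balaban1985Variational] (16)–(18): the element `U₀(Γ)⁻¹·U(Γ)` with a centre value in the middle):
if `g (emb y) = c` and `g x = V(Γ_{emb y,x})⁻¹ · c · U(Γ_{emb y,x})` then `(g • U)(Γ_{emb y,x}) = V(Γ_{emb y,x})`. [cite: Balaban1985Variational, (18) p.280] -/
theorem axialT_gaugeAct_of_stage {j : ℕ} (U V : GaugeField P j G) (g : Site P j → G) (y : Site P (j + 1)) (x : Site P j) (c : G)
    (hy : g (emb y) = c) (hx : g x = (axialT V (emb y) x)⁻¹ * c * axialT U (emb y) x) :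
    axialT (GaugeField.gaugeAct g U) (emb y) x = axialT V (emb y) x := by
  rw [← gaugeActT_eq_gaugeAct, axialT_gaugeActT, hy, hx]
  group

/-- **(T4b) THE BONDWISE READING OF COMB AXIALITY** (px8 g21's wish (w1): the form a bond-level consumer reads): if `W` and `V` have the same comb
holonomies from `c` to both endpoints of the bond `⟨x, μ⟩`, and for both fields the comb to `x + e_μ` is the comb to `x` followed by that bond (i.e. the
bond LIES ON the comb — a geometric fact about `treeWord`, the same for every field), then `W ⟨x, μ⟩ = V ⟨x, μ⟩`: the relative field is `1` EXACTLY on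
comb bonds.  Pure cancellation. [cite: Balaban1985RegularSpaces, (1.19) p.79] -/
theorem bond_eq_of_axial {j : ℕ} (W V : GaugeField P j G) (c x : Site P j) (μ : Fin P.d)
    (hax : axialT W c x = axialT V c x) (hax' : axialT W c (x.shift μ) = axialT V c (x.shift μ))
    (hW : axialT W c (x.shift μ) = axialT W c x * W ⟨x, μ⟩) (hV : axialT V c (x.shift μ) = axialT V c x * V ⟨x, μ⟩) :
    W ⟨x, μ⟩ = V ⟨x, μ⟩ := by
  have h : axialT V c x * W ⟨x, μ⟩ = axialT V c x * V ⟨x, μ⟩ :=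
    calc axialT V c x * W ⟨x, μ⟩ = axialT W c x * W ⟨x, μ⟩ := by rw [hax]
      _ = axialT W c (x.shift μ) := hW.symm
      _ = axialT V c (x.shift μ) := hax'
      _ = axialT V c x * V ⟨x, μ⟩ := hV
  exact mul_left_cancel h

/-- ★★★ **THE RELATIVE STAGE-GAUGE TOWER EXISTS** (px8 g21 UV3-NODE §57.8 (B), typed for ANY averagings `av` and ANY lift maps `lift`).  For
`m ≤ m_P + K_P` and a finest field `U` there is a gauge family `g_j : T^{(j)} → G` with: (T0) the stage recursion
`g_j x = (lift_j (g_{j+1} • M^{j+1}U))(Γ_{emb y,x})⁻¹ · g_{j+1} y · (M^jU)(Γ_{emb y,x})`, `y = blockOf x`, for `j < m`; (T1) `g_j ≡ 1` for `j ≥ m`;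
(T2) nesting `g_j (emb y) = g_{j+1} y`; (T3) covariance `M^j(g_0 • X) = g_j • M^jX` (`j ≤ m`, every `X`) and residuality `M^m(g_0 • X) = M^mX`; (T6) residuality of the inverse
`M^m(g_0⁻¹ • X) = M^mX`; (T4) comb axiality
of `U′_j := g_j • M^jU` RELATIVE TO `V_j := lift_j U′_{j+1}`; (T5) one-step consistency `M(U′_j) = U′_{j+1}`.
[cite: Balaban1985Variational, (16)-(18) p.280; Balaban1985RegularSpaces, (1.19) p.79; Balaban1985Averaging, (11) p.19] -/
theorem exists_stageGaugeTower (av : ∀ i, Averaging P i G) {m : ℕ} (hm : m ≤ P.m + P.K)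
    (lift : (j : ℕ) → GaugeField P (j + 1) G → GaugeField P j G) (U : GaugeField P 0 G) :
    ∃ g : (j : ℕ) → Site P j → G,
      (∀ j, j < m → ∀ x, g j x =
        (axialT (lift j (GaugeField.gaugeAct (g (j + 1)) (Averaging.iter av (j + 1) U))) (emb (blockOf x)) x)⁻¹ *
          g (j + 1) (blockOf x) * axialT (Averaging.iter av j U) (emb (blockOf x)) x) ∧
      (∀ j, m ≤ j → ∀ y, g j y = 1) ∧
      (∀ j, j < m → ∀ y : Site P (j + 1), g j (emb y) = g (j + 1) y) ∧
      (∀ X : GaugeField P 0 G, ∀ j, j ≤ m →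
        Averaging.iter av j (GaugeField.gaugeAct (g 0) X) = GaugeField.gaugeAct (g j) (Averaging.iter av j X)) ∧
      (∀ X : GaugeField P 0 G, Averaging.iter av m (GaugeField.gaugeAct (g 0) X) = Averaging.iter av m X) ∧
      (∀ X : GaugeField P 0 G, Averaging.iter av m (GaugeField.gaugeAct (fun x => (g 0 x)⁻¹) X) = Averaging.iter av m X) ∧
      (∀ j, j < m → ∀ x, axialT (GaugeField.gaugeAct (g j) (Averaging.iter av j U)) (emb (blockOf x)) x =
        axialT (lift j (GaugeField.gaugeAct (g (j + 1)) (Averaging.iter av (j + 1) U))) (emb (blockOf x)) x) ∧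
      (∀ j, j < m → (av j).avg (GaugeField.gaugeAct (g j) (Averaging.iter av j U)) =
        GaugeField.gaugeAct (g (j + 1)) (Averaging.iter av (j + 1) U)) := by
  -- §1 with the state-dependent stage step
  obtain ⟨g, h1, h0⟩ := exists_rec_of_top (S := fun j => Site P j → G) m (fun _ _ => 1)
    (fun j g' x => (axialT (lift j (GaugeField.gaugeAct g' (Averaging.iter av (j + 1) U))) (emb (blockOf x)) x)⁻¹ *
      g' (blockOf x) * axialT (Averaging.iter av j U) (emb (blockOf x)) x)
  -- (T0), (T1) pointwise
  have hT0 : ∀ j, j < m → ∀ x, g j x =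
      (axialT (lift j (GaugeField.gaugeAct (g (j + 1)) (Averaging.iter av (j + 1) U))) (emb (blockOf x)) x)⁻¹ *
        g (j + 1) (blockOf x) * axialT (Averaging.iter av j U) (emb (blockOf x)) x :=
    fun j hj x => congrFun (h0 j hj) x
  have hT1 : ∀ j, m ≤ j → ∀ y, g j y = 1 := fun j hj y => congrFun (h1 j hj) y
  -- (T2) nesting: the comb at a centre is empty on both sides
  have hT2 : ∀ j, j < m → ∀ y : Site P (j + 1), g j (emb y) = g (j + 1) y := by
    intro j hj y
    rw [hT0 j hj (emb y), Site.blockOf_emb (by omega), axialT_self, axialT_self, inv_one, one_mul, mul_one]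
  -- (T3) covariance along the tower, residuality at the top
  have hT3 : ∀ X : GaugeField P 0 G, ∀ j, j ≤ m →
      Averaging.iter av j (GaugeField.gaugeAct (g 0) X) = GaugeField.gaugeAct (g j) (Averaging.iter av j X) :=
    fun X => iter_gaugeAct_of_emb av hm g hT2 X
  have hgm : g m = fun _ => 1 := funext (hT1 m le_rfl)
  have hres : ∀ X : GaugeField P 0 G, Averaging.iter av m (GaugeField.gaugeAct (g 0) X) = Averaging.iter av m X := by
    intro X
    rw [hT3 X m le_rfl, hgm, T4AxialGaugeFixing.gaugeAct_const_one]
  -- (T6) the inverse family nests as well, hence `(g 0)⁻¹` is residual too (the EXIT's comparison gauge)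
  have hT6 : ∀ X : GaugeField P 0 G, Averaging.iter av m (GaugeField.gaugeAct (fun x => (g 0 x)⁻¹) X) = Averaging.iter av m X := by
    intro X
    have hemb' : ∀ j, j < m → ∀ y : Site P (j + 1), (fun (i : ℕ) (z : Site P i) => (g i z)⁻¹) j (emb y) =
        (fun (i : ℕ) (z : Site P i) => (g i z)⁻¹) (j + 1) y := fun j hj y => by simp only [hT2 j hj y]
    rw [iter_gaugeAct_of_emb av hm (fun i z => (g i z)⁻¹) hemb' X m le_rfl]
    have hgm' : (fun z : Site P m => (g m z)⁻¹) = fun _ => 1 := funext fun z => by rw [hT1 m le_rfl z, inv_one]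
    rw [hgm', T4AxialGaugeFixing.gaugeAct_const_one]
  -- (T4) comb axiality relative to the lift
  have hT4 : ∀ j, j < m → ∀ x, axialT (GaugeField.gaugeAct (g j) (Averaging.iter av j U)) (emb (blockOf x)) x =
      axialT (lift j (GaugeField.gaugeAct (g (j + 1)) (Averaging.iter av (j + 1) U))) (emb (blockOf x)) x :=
    fun j hj x => axialT_gaugeAct_of_stage _ _ (g j) (blockOf x) x (g (j + 1) (blockOf x)) (hT2 j hj (blockOf x)) (hT0 j hj x)
  -- (T5) one-step consistency
  have hT5 : ∀ j, j < m → (av j).avg (GaugeField.gaugeAct (g j) (Averaging.iter av j U)) =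
      GaugeField.gaugeAct (g (j + 1)) (Averaging.iter av (j + 1) U) := by
    intro j hj
    rw [← hT3 U j hj.le, ← hT3 U (j + 1) (by omega)]
    rfl
  exact ⟨g, hT0, hT1, hT2, hT3, hres, hT6, hT4, hT5⟩

end Tower

/-! ## §3 The dock for the (ii-b) face corollary: a lift that is a SECTION of a coarse reading reproduces the one-step average of the current field -/

section Dock

variable {P : Params} {G : Type*} [GaugeGroup G]

/-- **THE BACKGROUND REPRODUCES THE AVERAGE OF THE CURRENT FIELD** (the hypothesis shape of px13 g22's (ii-b) face corollary, «`rowProd U₀ (emb c.src)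
c.dir L = avgFun ℰ W c`»): if the lift is a section of a coarse reading `cavg` (px12 g23 (W1) `axialAvg (lift X) = X`) then along the tower
`cavg (V_j) = M(U′_j)` with `V_j = lift_j U′_{j+1}`, by (T5). [cite: Balaban1987RG1, (0.4) p.253] -/
theorem stage_coarse_eq_avg_of_section {j : ℕ} (av : Averaging P j G) (lift : GaugeField P (j + 1) G → GaugeField P j G)
    (cavg : GaugeField P j G → GaugeField P (j + 1) G) (hsec : ∀ X, cavg (lift X) = X)
    (U' : GaugeField P j G) (U'' : GaugeField P (j + 1) G) (hT5 : av.avg U' = U'') :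
    cavg (lift U'') = av.avg U' := by
  rw [hsec, hT5]

end Dock

end Summit.QuantumFields.YangMills.Theorems.FluctuationComparisonRegPrIntLS2BetaStageGaugeTower
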